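import Summits.CriticalPhenomena.PercolationContinuityZ3.Theorems.PercNearOneGluingNoHeavyLowerTailKNGoodPocketBHK
import Literature.Probability.Percolation.TwoSetConditionalAssociation
import HarnessLib

/-!
# `NoHeavyLowerTail` (stmt-CriticalPhenomena-4575) — the POCKET-AUGMENTED van den Berg–Häggström–Kahn
# inequality, IV: vertex SETS (the hub transport)

Support file (`--supports stmt-CriticalPhenomena-4575`, hull-port prover `prim-hp-2`, gen 21).  No named facts, no
sorries; standard axioms.  Fourth file of the series (`…KNGoodPocketBHKBase/Restrict/·.lean`).

The pocket-augmented BHK theorem of file III is stated for a single source vertex `s`.  As in BHK's Remark 1 (and the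
tree's `TwoSetConditionalAssociation.lean`, whose hub machinery on `V ⊕ Bool` is reused verbatim), a vertex SET `S`
is glued to a hub `inr true` by surely-open pairs and `T` to `inr false`:

* `KNGoodPocketBHK.pocketAugSet S o 𝒬 = {o ↔ S} ∪ {C(o) ∈ 𝒬}`, `KNGoodPocketBHK.avoidSet S T = {S ↮ T}`;
* `KNGoodPocketBHK.openCluster_hub_inl` — in the hub configuration the cluster of `inl o` is the image of `C(o)`
  when `o` is joined to neither block;
* `KNGoodPocketBHK.real_pocketAugSet_openConn_ge` — **for vertex sets `S, T`, `a ∈ S`, any `b, o`, and ANY family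
  `𝒬` of vertex sets disjoint from `T`:  `μ({a↔b} ∩ D) · μ(F ∩ D) ≤ μ(D) · μ({a↔b} ∩ F ∩ D)`**, `D = {S ↮ T}`,
  `F = {o ↔ S} ∪ {C(o) ∈ 𝒬}` (the event `{a ↔ b}` being increasing and determined by the edge cluster of the hub).

With `S = {a, b}`, `T = {c}` three relays of a separated Kozma–Nitzan quadruple, applied to the B-side weights,
this is `P(F | a↔b, c↮ab) ≥ P(F | c↮ab)`, i.e. the B-side inequality (I) of the `|A| = 3` goodness reduction R3
(prim-hp-2 MEMO-gen12 §6) for every pocket family; all eight inequalities of Conjecture B3 follow (MEMO-gen21 §3).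
[cite: VandenbergHaggstromKahn2005, Remark 1 after Thm. 1.2 (p. 5)] [cite: KozmaNitzan2024, §3.2 (p. 12)]
-/

noncomputable section

namespace Summit.CriticalPhenomena.PercolationContinuityZ3.Theorems

open MeasureTheory Set Literature.Probability.LatticeModels Literature.Probability.Percolation
open scoped Classical

namespace KNGoodPocketBHK

variable {V : Type*}

/-! ### Two vertex SETS: the hub transport (BHK Remark 1) -/

section TwoSets

open TwoSetConditionalAssociation

variable [Fintype V]

/-- The pocket-augmented event for a SET source: `F = {o ↔ S} ∪ {C(o) ∈ 𝒬}`.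
[cite: KozmaNitzan2024, §3.2 p. 12 (the events `C(0) = W`)] -/
def pocketAugSet (S : Set V) (o : V) (Q : Set (Set V)) : Set (BondConfig V) :=
  {ω | (∃ s ∈ S, (openGraph ω).Reachable o s) ∨ openCluster ω o ∈ Q}

/-- `{S ↮ T}`. [cite: VandenbergHaggstromKahn2005, §2 p. 6] -/
def avoidSet (S T : Set V) : Set (BondConfig V) := {ω | ∀ s ∈ S, ∀ t ∈ T, ¬ (openGraph ω).Reachable s t}

omit [Fintype V] in
/-- In the hub configuration, the cluster of `inl o` is the image of the cluster of `o` when `o` is joined to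
neither block. [folklore] -/
theorem openCluster_hub_inl (side : Bool → Set V) (ω : BondConfig V) (o : V)
    (ho : ∀ b : Bool, ∀ u ∈ side b, ¬ (openGraph ω).Reachable o u) :
    openCluster (hubConfig side ω) (Sum.inl o) = Sum.inl '' openCluster ω o := by
  refine Set.Subset.antisymm ?_ ?_
  · intro x hx
    -- the image of `C(o)` is closed under adjacency in the hub configuration
    have hcl : ∀ ⦃x y : V ⊕ Bool⦄, x ∈ Sum.inl '' openCluster ω o → (openGraph (hubConfig side ω)).Adj x y →
        y ∈ Sum.inl '' openCluster ω o := by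
      rintro x y ⟨u, hu, rfl⟩ hxy
      rw [openGraph_adj, mem_hubConfig_iff] at hxy
      obtain ⟨⟨e, he, hexy⟩ | ⟨b', u', hu', hexy⟩, hne⟩ := hxy
      · induction e using Sym2.ind with
        | h p q =>
          rw [Sym2.map_mk, Sym2.eq_iff] at hexy
          have step : ∀ {p q : V}, s(p, q) ∈ ω → (Sum.inl p : V ⊕ Bool) = Sum.inl u → (Sum.inl q : V ⊕ Bool) = y →
              y ∈ Sum.inl '' openCluster ω o := by
            intro p q hpq hp hq
            cases Sum.inl_injective hp
            subst hq
            refine ⟨q, ?_, rfl⟩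
            exact (hu : (openGraph ω).Reachable o _).trans
              (SimpleGraph.Adj.reachable ((openGraph_adj ω _ _).2 ⟨hpq, fun h => hne (by rw [h])⟩))
          rcases hexy with ⟨hp, hq⟩ | ⟨hp, hq⟩
          · exact step he hp hq
          · exact step (by rw [Sym2.eq_swap]; exact he) hq hp
      · exfalso
        rw [Sym2.eq_iff] at hexy
        rcases hexy with ⟨h1, -⟩ | ⟨h1, -⟩
        · cases Sum.inl_injective h1
          exact ho b' u hu' hu
        · exact Sum.inl_ne_inr h1
    exact mem_of_reachable_of_closed hcl ⟨o, mem_openCluster_self ω o, rfl⟩ hx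
  · rintro x ⟨u, hu, rfl⟩
    exact hubConfig_reachable_inl side hu

/-- **COROLLARY (II) for vertex SETS.**  For bond percolation on a finite graph, vertex sets `S, T`, vertices
`a ∈ S`, `b`, `o`, and ANY family `𝒬` of vertex sets disjoint from `T`, with `D = {S ↮ T}` and
`F = {o ↔ S} ∪ {C(o) ∈ 𝒬}`:   `μ({a↔b} ∩ D) · μ(F ∩ D) ≤ μ(D) · μ({a↔b} ∩ F ∩ D)` — given `S ↮ T`, the
pocket-augmented event is positively correlated with `{a ↔ b}` (an increasing event of the edge cluster of `S`).
Proof: `real_pocketAug_inter_ge` on the hub graph `V ⊕ Bool` of `TwoSetConditionalAssociation` (`S` glued to the hub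
`inr true`, `T` to `inr false`).  With `S = {a,b}`, `T = {c}` three relays this is inequality (I) of the `|A| = 3`
goodness reduction: `P(F | a↔b, c↮ab) ≥ P(F | c↮ab)`.
[cite: VandenbergHaggstromKahn2005, Remark 1 after Thm. 1.2 (p. 5)] [cite: KozmaNitzan2024, §3.2 (p. 12)] -/
theorem real_pocketAugSet_openConn_ge (w : Sym2 V → unitInterval) (S T : Set V) (a b o : V) (ha : a ∈ S)
    (Q : Set (Set V)) (hQ : ∀ W ∈ Q, Disjoint W T) :
    (prodBernoulli w).real (openConn a b ∩ avoidSet S T) * (prodBernoulli w).real (pocketAugSet S o Q ∩ avoidSet S T) ≤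
      (prodBernoulli w).real (avoidSet S T) *
        (prodBernoulli w).real (openConn a b ∩ (pocketAugSet S o Q ∩ avoidSet S T)) := by
  classical
  set side := sides S T with hside
  -- the data on the hub graph
  set Q' : Set (Set (V ⊕ Bool)) := (Set.image Sum.inl) '' Q with hQ'
  set A' : Set (BondConfig (V ⊕ Bool)) :=
    {ω' | s(Sum.inl a, Sum.inr true) ∈ ω' ∧ (openGraph (restrictConfig Sum.inl ω')).Reachable a b} with hA'
  have hQ'T : ∀ W' ∈ Q', Disjoint W' ({Sum.inr false} : Set (V ⊕ Bool)) := by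
    rintro W' ⟨W, -, rfl⟩
    rw [Set.disjoint_singleton_right]
    rintro ⟨v, -, hv⟩
    exact Sum.inl_ne_inr hv
  have hA'det : ∀ ω' ω'', ω' ∈ A' → openEdgeCluster ω' (Sum.inr true) ⊆ openEdgeCluster ω'' (Sum.inr true) →
      ω'' ∈ A' := by
    rintro ω' ω'' ⟨hhub, hreach⟩ hsub
    -- every old open pair on an open path from `a` lies in the cluster of the hub
    have hahub : (openGraph ω').Reachable (Sum.inr true) (Sum.inl a) :=
      SimpleGraph.Adj.reachable ((openGraph_adj ω' _ _).2 ⟨by rw [Sym2.eq_swap]; exact hhub, Sum.inr_ne_inl⟩)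
    have hhubmem : s(Sum.inl a, Sum.inr true) ∈ openEdgeCluster ω' (Sum.inr true) := by
      refine (mem_openEdgeCluster_iff _ _ _).2 ⟨hhub, ?_, fun v hv => ?_⟩
      · rw [Sym2.mk_isDiag_iff]; exact Sum.inl_ne_inr
      · rcases Sym2.mem_iff.1 hv with rfl | rfl
        · exact hahub
        · exact SimpleGraph.Reachable.refl _
    refine ⟨(hsub hhubmem).1, ?_⟩
    -- transfer the path edge by edge
    rw [SimpleGraph.reachable_iff_reflTransGen] at hreach
    have key : ∀ v, Relation.ReflTransGen (openGraph (restrictConfig Sum.inl ω')).Adj a v →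
        (openGraph (restrictConfig Sum.inl ω'')).Reachable a v ∧ (openGraph ω').Reachable (Sum.inr true) (Sum.inl v) := by
      intro v hv
      induction hv with
      | refl => exact ⟨SimpleGraph.Reachable.refl a, hahub⟩
      | @tail p q _ hpq ih =>
        rw [openGraph_adj, mem_restrictConfig, Sym2.map_mk] at hpq
        have hq' : (openGraph ω').Reachable (Sum.inr true) (Sum.inl q) :=
          ih.2.trans (SimpleGraph.Adj.reachable ((openGraph_adj ω' _ _).2
            ⟨hpq.1, fun h => hpq.2 (Sum.inl_injective h)⟩))
        have hmem : s(Sum.inl p, Sum.inl q) ∈ openEdgeCluster ω' (Sum.inr true) := by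
          refine (mem_openEdgeCluster_iff _ _ _).2 ⟨hpq.1, ?_, fun v hv => ?_⟩
          · rw [Sym2.mk_isDiag_iff]; exact fun h => hpq.2 (Sum.inl_injective h)
          · rcases Sym2.mem_iff.1 hv with rfl | rfl
            · exact ih.2
            · exact hq'
        refine ⟨ih.1.trans (SimpleGraph.Adj.reachable ((openGraph_adj _ _ _).2 ⟨?_, hpq.2⟩)), hq'⟩
        rw [mem_restrictConfig, Sym2.map_mk]
        exact (hsub hmem).1
    exact (key b hreach).1
  have key := real_pocketAug_inter_ge (hubWeight w side) (Sum.inr true) (Sum.inl o) {Sum.inr false} Q' hQ'T A' hA'det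
  simp only [measureReal_hub] at key
  -- identification of the four preimages
  have hD : hubConfig side ⁻¹' avoid (Sum.inr true) ({Sum.inr false} : Set (V ⊕ Bool)) = avoidSet S T := by
    have h1 : avoid (Sum.inr true) ({Sum.inr false} : Set (V ⊕ Bool)) =
        {ω' | ¬ (openGraph ω').Reachable (Sum.inr true) (Sum.inr false)} := by
      ext ω'; simp only [avoid, Set.mem_singleton_iff, forall_eq, Set.mem_setOf_eq]
    rw [h1, hubConfig_preimage_not_reachable]
    ext ω; simp only [hside, sides_true, sides_false, avoidSet, Set.mem_setOf_eq]
  have hA : hubConfig side ⁻¹' A' = openConn a b := by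
    ext ω
    simp only [hA', Set.mem_preimage, Set.mem_setOf_eq, restrictConfig_hubConfig, openConn]
    exact ⟨fun h => h.2, fun h => ⟨Or.inr ⟨true, a, by simpa [hside] using ha, rfl⟩, h⟩⟩
  have hF : ∀ ω ∈ avoidSet S T, hubConfig side ω ∈ pocketAug (Sum.inr true) (Sum.inl o) Q' ↔ ω ∈ pocketAugSet S o Q := by
    intro ω hω
    have hsep : ∀ s ∈ side true, ∀ t ∈ side (!true), ¬ (openGraph ω).Reachable s t := by
      intro s hs t ht
      simp only [hside, sides_true, sides_false, Bool.not_true] at hs ht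
      exact hω s hs t ht
    simp only [pocketAug, pocketAugSet, Set.mem_setOf_eq]
    constructor
    · rintro (h | h)
      · obtain ⟨s, hs, hso⟩ := exists_reachable_of_hub_reachable side ω true hsep h.symm
        exact Or.inl ⟨s, by simpa [hside] using hs, hso.symm⟩
      · -- the hub cluster of `inl o` is an image set, so `o` is joined to neither block
        obtain ⟨W, hW, hWeq⟩ := h
        by_cases hoS : ∃ s ∈ S, (openGraph ω).Reachable o s
        · exact Or.inl hoS
        have hoT : ∀ t ∈ T, ¬ (openGraph ω).Reachable o t := by
          intro t ht hot
          have : Sum.inr false ∈ openCluster (hubConfig side ω) (Sum.inl o) :=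
            (hubConfig_reachable_inl side hot).trans
              (hubConfig_adj_hub side ω (b := false) (by simpa [hside] using ht)).reachable.symm
          rw [← hWeq] at this
          obtain ⟨v, -, hv⟩ := this
          exact Sum.inl_ne_inr hv
        have ho : ∀ b' : Bool, ∀ u ∈ side b', ¬ (openGraph ω).Reachable o u := by
          rintro (_ | _) u hu
          · exact hoT u (by simpa [hside] using hu)
          · exact fun h => hoS ⟨u, by simpa [hside] using hu, h⟩
        rw [openCluster_hub_inl side ω o ho] at hWeq
        rw [Set.image_injective.2 Sum.inl_injective hWeq] at hW
        exact Or.inr hW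
    · rintro (⟨s, hs, hos⟩ | h)
      · exact Or.inl ((hubConfig_reachable_hub_inl side ω (b := true) (by simpa [hside] using hs) hos.symm).symm)
      · by_cases hoS : ∃ s ∈ S, (openGraph ω).Reachable o s
        · obtain ⟨s, hs, hos⟩ := hoS
          exact Or.inl ((hubConfig_reachable_hub_inl side ω (b := true) (by simpa [hside] using hs) hos.symm).symm)
        have hoT : ∀ t ∈ T, ¬ (openGraph ω).Reachable o t := fun t ht hot =>
          Set.disjoint_left.1 (hQ _ h) (show t ∈ openCluster ω o from hot) ht
        have ho : ∀ b' : Bool, ∀ u ∈ side b', ¬ (openGraph ω).Reachable o u := by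
          rintro (_ | _) u hu
          · exact hoT u (by simpa [hside] using hu)
          · exact fun h' => hoS ⟨u, by simpa [hside] using hu, h'⟩
        refine Or.inr ⟨openCluster ω o, h, ?_⟩
        rw [openCluster_hub_inl side ω o ho]
  have hFD : hubConfig side ⁻¹' (pocketAug (Sum.inr true) (Sum.inl o) Q' ∩ avoid (Sum.inr true) {Sum.inr false}) =
      pocketAugSet S o Q ∩ avoidSet S T := by
    ext ω
    rw [Set.preimage_inter, hD, Set.mem_inter_iff, Set.mem_inter_iff, Set.mem_preimage]
    exact ⟨fun h => ⟨(hF ω h.2).1 h.1, h.2⟩, fun h => ⟨(hF ω h.2).2 h.1, h.2⟩⟩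
  have e1 : hubConfig side ⁻¹' (A' ∩ avoid (Sum.inr true) {Sum.inr false}) = openConn a b ∩ avoidSet S T := by
    rw [Set.preimage_inter, hA, hD]
  have e4 : hubConfig side ⁻¹' (A' ∩ (pocketAug (Sum.inr true) (Sum.inl o) Q' ∩ avoid (Sum.inr true) {Sum.inr false})) =
      openConn a b ∩ (pocketAugSet S o Q ∩ avoidSet S T) := by
    rw [Set.preimage_inter, hA, hFD]
  rw [e1, hFD, hD, e4] at key
  exact key

end TwoSets

end KNGoodPocketBHK

end Summit.CriticalPhenomena.PercolationContinuityZ3.Theorems
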